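import Summits.ABC.ABC.Statement
import Summits.ABC.ABC.Theses.TwistAmplification
import Summits.ABC.ABC.Theorems.TwistAmplificationModerateWindowCountInertBox
import Summits.ABC.ABC.Theorems.TwistAmplificationSomeWindowSavingQuadraticTwistInvariants
import Summits.ABC.ABC.Theorems.TwistAmplificationSharpLawGivesWindow
import HarnessLib

/-!
# Crux `ModerateWindowCount` (stmt-ABC-1973): the CALIBRATION, now unconditional

Line lead prover-line-stmt-ABC-1973-1 (cycle 2 of the crux, 2026-08-16), line `SketchIdeator3`.

The previous cycle landed `moderateWindowCount_iff_abc : QuadraticTwistInvariants → (ModerateWindowCount ↔ ABC)`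
(`Theorems/TwistAmplificationModerateWindowCountInertBox.lean`, p85659), i.e. the crux is the summit
MODULO the route support `QuadraticTwistInvariants` (stmt-ABC-1977, Tate's algorithm for prime-to-`6N`
quadratic twists). That support has since been PROVED (`quadraticTwistInvariants_proof`, p87180, landed by
the sibling crux's lead in `Theorems/TwistAmplificationSomeWindowSavingQuadraticTwistInvariants.lean`),
so every hypothesis can now be discharged. This file records the resulting UNCONDITIONAL position of the
crux, with no named-fact hypothesis anywhere:

* `moderateWindowCount_equiv_abc` — **`ModerateWindowCount ↔ ABC`**. The crux as typed IS the summit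
  (registered on the crux item as the sub-goal of this cycle).
* `ModerateWindowCount.iff_cofiniteGenSzpiroAll` — `ModerateWindowCount ↔` (cofinite generalized Szpiro
  for every exponent `s > 6` on minimal integral models with `c₄ c₆ ≠ 0`) — the registered stub
  `stub_cofiniteGenSzpiroAll` of line `SketchIdeator3` is EQUIVALENT to the crux, so the line is lossless
  and its one stub is abc.
* `ModerateWindowCount.iff_generalizedSzpiroBG` — `ModerateWindowCount ↔ GeneralizedSzpiroConjectureBG`
  (Bombieri–Gubler Conj. 12.5.11, the catalogued Literature conjecture; verbatim the statement of item
  stmt-ABC-10576 `CMRescueSzpiro.Target`).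
* `abc_of_sharpModerateLaw` — **`SharpModerateLaw → ABC`**: with stmt-ABC-1977, stmt-ABC-1978,
  stmt-ABC-14144 and the Assembly stmt-ABC-10440 all closed, route TwistAmplification now hinges on the
  single open crux `SharpModerateLaw` (stmt-ABC-1975); the closing `example` is the route's deciding
  theorem `closes` with every closed item supplied, leaving exactly that hypothesis (plus four it ignores).

Consequences for the crux chain (numbers, not adjectives): any stub set of any line composing to
`ModerateWindowCount` implies `ABC` outright (`ModerateWindowCount.abc_of`); any unconditional refutation
of the crux or of a necessary stub is a proof of `¬ ABC`; inside the route the node is derived from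
stmt-ABC-1975 (`sharpLawGivesWindow_proof`) and is not used by `closes` (its `_hCount` is ignored).
Lands `--supports stmt-ABC-1973`.
-/

noncomputable section

open IsDedekindDomain WeierstrassCurve
open Summit.ABC.ABC.Theses.TwistAmplification (ModerateWindowCount SharpModerateLaw SomeWindowSaving
  MazurKaneLaw QuadraticTwistInvariants TwistAmplificationLemma FreyAmplification SharpCountSandwich
  SharpLawGivesWindow Assembly)
open Literature.NumberTheory.EllipticCurves (GeneralizedSzpiroConjectureBG)

-- `Summit.<Summit>.<Problem>` is the mandated summit-side namespace (CONVENTIONS §2); for the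
-- single-conjunct summit `ABC` the two coincide, so the duplicate `ABC.ABC` is deliberate.
set_option linter.dupNamespace false

namespace Summit.ABC.ABC.Theorems

/-- **CALIBRATION OF THE CRUX, UNCONDITIONAL: `ModerateWindowCount ↔ ABC`.** The modulo-1977 calibration
`moderateWindowCount_iff_abc` with its only hypothesis discharged by `quadraticTwistInvariants_proof`
(stmt-ABC-1977, closed). `→`: twist amplification (`twistAmplificationLemma_proof`, stmt-ABC-1978) +
Frey bookkeeping + Mahler (`twistAmplification_assembly_proof`, stmt-ABC-10440); `←`: Bombieri–Gubler
Thm. 12.5.12 (`abcLe_iff_generalizedSzpiroBG_holds`) and the inert box `κ := (σ+6)/2`, `δ := 0`.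
[cite: BombieriGubler2006, Thm. 12.5.12] -/
theorem moderateWindowCount_equiv_abc :
    Summit.ABC.ABC.Theses.TwistAmplification.ModerateWindowCount ↔ _root_.ABC :=
  moderateWindowCount_iff_abc quadraticTwistInvariants_proof

/-- The crux implies the summit, unconditionally (so every stub set of every line of this crux is at
least abc). [folklore] -/
theorem ModerateWindowCount.abc_of (h : ModerateWindowCount) : _root_.ABC :=
  moderateWindowCount_equiv_abc.mp h

/-- **The registered stub of line `SketchIdeator3` is EQUIVALENT to the crux (unconditional):**
`ModerateWindowCount ↔` cofinite generalized Szpiro for every exponent `s > 6` on the minimal integral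
models with `c₄ c₆ ≠ 0` (the right-hand side is `stub_cofiniteGenSzpiroAll` verbatim). `→` is
`cofiniteGenSzpiroAll_of_moderateWindowCount` at `quadraticTwistInvariants_proof`; `←` is the inert box
`moderateWindowCount_of_cofiniteGenSzpiroAll`. [folklore] -/
theorem ModerateWindowCount.iff_cofiniteGenSzpiroAll :
    ModerateWindowCount ↔
      ∀ s : ℝ, 6 < s → ∃ N₀ : ℝ, ∀ W₀ : WeierstrassCurve ℤ, (W₀.baseChange ℚ).IsElliptic →
        (∀ v : HeightOneSpectrum ℤ, (W₀.baseChange ℚ).IsMinimalAt v) → W₀.c₄ ≠ 0 → W₀.c₆ ≠ 0 →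
          N₀ ≤ (((W₀.baseChange ℚ).conductorNorm ℤ : ℕ) : ℝ) →
            ((max |W₀.Δ| (|W₀.c₄| ^ 3) : ℤ) : ℝ) ≤ (((W₀.baseChange ℚ).conductorNorm ℤ : ℕ) : ℝ) ^ s :=
  ⟨cofiniteGenSzpiroAll_of_moderateWindowCount quadraticTwistInvariants_proof,
    moderateWindowCount_of_cofiniteGenSzpiroAll⟩

/-- **`ModerateWindowCount ↔ GeneralizedSzpiroConjectureBG`** (Bombieri–Gubler Conj. 12.5.11 as catalogued
in `Literature.NumberTheory.EllipticCurves.Szpiro`; verbatim item stmt-ABC-10576). `→` through `ABC`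
(`ModerateWindowCount.abc_of`, then B–G 12.5.12 `ModerateWindowCount.generalizedSzpiroBG_of_abc`);
`←` is the landed `moderateWindowCount_of_generalizedSzpiroBG`. [cite: BombieriGubler2006, Thm. 12.5.12] -/
theorem ModerateWindowCount.iff_generalizedSzpiroBG :
    ModerateWindowCount ↔ GeneralizedSzpiroConjectureBG :=
  ⟨fun h ↦ ModerateWindowCount.generalizedSzpiroBG_of_abc (ModerateWindowCount.abc_of h),
    moderateWindowCount_of_generalizedSzpiroBG⟩

/-- **Route TwistAmplification hinges on ONE item: `SharpModerateLaw → ABC`** (unconditional). The crux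
`SharpModerateLaw` (stmt-ABC-1975) gives `ModerateWindowCount` by the closed glue
`sharpLawGivesWindow_proof` (stmt-ABC-14144, `κ := 4`), and `ModerateWindowCount` is the summit
(`moderateWindowCount_equiv_abc`). [folklore] -/
theorem abc_of_sharpModerateLaw (h : SharpModerateLaw) : _root_.ABC :=
  ModerateWindowCount.abc_of (sharpLawGivesWindow_proof h)

-- buildfix 2026-08-19 (ops-buildfix lane): the trailing regression `example … : _root_.ABC := closes …` and the
-- `closes` entry of the `open … (…)` list were removed — route TwistAmplification was CLOSED (retired,
-- 2026-08-17T04:29Z) and its deciding theorem `closes` no longer exists, so the example stopped elaborating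
-- (`Unknown constant …TwistAmplification.closes`) and with it this module and its importers. No declaration
-- changed: the example was not a declaration; `abc_of_sharpModerateLaw` above is the same regression content.

end Summit.ABC.ABC.Theorems

end
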